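import Summits.BirchSwinnertonDyer.BirchSwinnertonDyer.Theorems.Rank1ResidualJetSection6BridgeMin
import HarnessLib

/-!
# T1 JET (cell `bsd-jet`), road K — striking McCallum 1991 Prop. 5.2 (`h52`), brick 5: the §6 BRIDGE
# (minimal form) with `h52` REPLACED by «level raising at minimal depth» (`hraise`, the conclusion of
# brick 4 `Swap.exists_conductor_levelIndex_ge_of_minDepth`)

HONEST FRAMING (programme file §HONESTY, verbatim): «no tranche here proves BSD; ARM L moves the
LITERAL column of an r ≤ 1 census into the kernel-proved-modulo-named-print column.» THEOREMS ONLY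
(seat `bsd-jet-pv-2`, session g6; `--supports stmt-BirchSwinnertonDyer-14418`, helper); 0 classes move;
road-K DOCUMENTARY. Nothing is asserted about any curve; no item closes.

WHAT. `derivedPoint_divisible_of_levelRaising_of_section6_min` = pv-2 g2's
`derivedPoint_divisible_of_prop52_of_section6_min` (`Rank1ResidualJetSection6BridgeMin`) VERBATIM except
that the named-print binder `h52 : McCallum1991.prop52_exists_conductor_kolyvaginClass_order_eq` is
replaced by `hraise` — the statement «from a conductor of Kolyvagin primes of index `≥ 1 + u` with a
datum of depth `< u + 1`, `u` MINIMAL among such depths, reach index `≥ max m' (1 + u)` keeping a datum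
of depth `< u + 1`», which is exactly what the proof's step `hK` used Prop. 5.2 for, and which brick 4
(`Swap.exists_conductor_levelIndex_ge_of_minDepth`, Kolyvagin's prime-swap walk in the kernel) proves
modulo {McCallum 4.4, the Poitou–Tate package, [GZ86 III (3.1)], the walk's local inputs, `hcompat`}.
The minimality premiss of `hraise` is discharged here from the definition of `m_∞` (a non-`p^{m_∞}`-
divisible derived point has an exact depth `u' < m_∞` in the competitor set `T`). Everything else
(`Λ`, `m'(c)`, `m(c)`, `m_∞`, `hmInf`, `hmeq`, the §6 end form) is the g2 text.
References (locators only): [cite: Jetchev2008, Proof of Thm. 1.4 (p. 824–825), §3.1 item 5]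
[cite: McCallumLMS1991, §5 Prop. 5.2 (p. 304)]. Design: no definitions; `K : Type`. Axioms: `propext`,
`Classical.choice`, `Quot.sound`.
-/

set_option autoImplicit false

noncomputable section

open scoped Classical

open WeierstrassCurve Literature.NumberTheory.EllipticCurves
  Literature.NumberTheory.EllipticCurves.ModularForms

namespace Summit.BirchSwinnertonDyer.Rank1Residual.JET

/-- **The bridge, minimal form, with McCallum Prop. 5.2 replaced by LEVEL RAISING AT MINIMAL DEPTH
(`hraise`).** Statement and proof of `derivedPoint_divisible_of_prop52_of_section6_min` with the step
`hK` fed by `hraise` at `u := m_∞` (its minimality premiss from the definition of `m_∞`); the frame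
hypotheses McCallum's fact needed (`¬CM`, `d_K`, Heegner, `p ≠ 2`, the tower, `y_K` of infinite order)
are no longer used at this stage — they move to the supplier of `hraise`.
[cite: Jetchev2008, Proof of Thm. 1.4 (p. 825), §3.1 item 5 (p. 817)] [cite: McCallumLMS1991, §5 Prop. 5.2 (p. 304)] -/
theorem derivedPoint_divisible_of_levelRaising_of_section6_min
    (W : WeierstrassCurve ℚ) [W.IsElliptic] [W.IsGloballyMinimal] [NeZero (W.conductorNorm ℤ)]
    (K : Type) [Field K] [NumberField K]
    (p : ℕ) [Fact p.Prime]
    (Dt : ModularParametrizationData W (W.conductorNorm ℤ)) (β : ℤ) (ι : K →+* ℂ) (t : ℕ)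
    (hraise : ∀ (u : ℕ),
      (∀ (c : ℕ), Squarefree c →
        (∀ q ∈ c.primeFactors, Zhang2014.IsKolyvaginPrime (W.conductorNorm ℤ) W K p q ∧
          1 + u ≤ Zhang2014.kolyvaginIndex W p q) →
        ∀ dc : KolyvaginHeegnerData Dt β ι c,
        ∃ Q : (W.baseChange (ringClassField K ι c)).toAffine.Point,
          ((p ^ u : ℕ) : ℤ) • Q = dc.derivedPoint) →
      ∀ (n₀ : ℕ), Squarefree n₀ →
        (∀ q ∈ n₀.primeFactors, Zhang2014.IsKolyvaginPrime (W.conductorNorm ℤ) W K p q ∧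
          1 + u ≤ Zhang2014.kolyvaginIndex W p q) →
        ∀ d₀ : KolyvaginHeegnerData Dt β ι n₀,
        (¬ ∃ Q : (W.baseChange (ringClassField K ι n₀)).toAffine.Point,
          ((p ^ (u + 1) : ℕ) : ℤ) • Q = d₀.derivedPoint) →
        ∀ m' : ℕ, ∃ (n : ℕ) (d : KolyvaginHeegnerData Dt β ι n), Squarefree n ∧
          (∀ q ∈ n.primeFactors, Zhang2014.IsKolyvaginPrime (W.conductorNorm ℤ) W K p q ∧
            max m' (1 + u) ≤ Zhang2014.kolyvaginIndex W p q) ∧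
          ¬ ∃ Q : (W.baseChange (ringClassField K ι n)).toAffine.Point,
            ((p ^ (u + 1) : ℕ) : ℤ) • Q = d.derivedPoint)
    (H : ∀ (mdiv m : {c : ℕ // Squarefree c ∧ ∀ ℓ ∈ c.primeFactors,
          Zhang2014.IsKolyvaginPrime (W.conductorNorm ℤ) W K p ℓ} → ℕ∞),
      (∀ c (u : ℕ), (u : ℕ∞) ≤ mdiv c ↔ ∀ d : KolyvaginHeegnerData Dt β ι c.1,
        ∃ Q : (W.baseChange (ringClassField K ι c.1)).toAffine.Point,
          ((p ^ u : ℕ) : ℤ) • Q = d.derivedPoint) →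
      (∀ c, m c = if mdiv c < Zhang2014.levelIndex W p c.1 then mdiv c else ⊤) →
      ∀ mInf : ℕ, (∀ c, (mInf : ℕ∞) ≤ m c) →
        (∀ m' : ℕ, ∃ c, (m' : ℕ∞) ≤ Zhang2014.levelIndex W p c.1 ∧ m c = mInf) →
      ∃ Core : ℕ → {c : ℕ // Squarefree c ∧ ∀ ℓ ∈ c.primeFactors,
          Zhang2014.IsKolyvaginPrime (W.conductorNorm ℤ) W K p ℓ} → Prop,
        (∀ (k : ℕ) c, 1 ≤ k → m c = mInf → (mInf : ℕ∞) + k ≤ Zhang2014.levelIndex W p c.1 →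
          ∃ c', Core k c' ∧ (k : ℕ∞) + mInf ≤ Zhang2014.levelIndex W p c'.1 ∧ m c' ≤ mInf) ∧
        (∀ (k : ℕ) c, 1 ≤ k → Core k c → m c = mInf →
          (k : ℕ∞) + mInf ≤ Zhang2014.levelIndex W p c.1 → t < k → mInf < k → t ≤ mInf))
    (s : ℕ) (hs : s ≤ t) (n : ℕ) (d : KolyvaginHeegnerData Dt β ι n) (hn : Squarefree n)
    (hℓ : ∀ ℓ ∈ n.primeFactors, Zhang2014.IsKolyvaginPrime (W.conductorNorm ℤ) W K p ℓ ∧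
      s ≤ Zhang2014.kolyvaginIndex W p ℓ) :
    ∃ Q : (W.baseChange (ringClassField K ι n)).toAffine.Point,
      ((p ^ s : ℕ) : ℤ) • Q = d.derivedPoint := by
  -- the conductor type and the divisibility predicate
  set Λ := {c : ℕ // Squarefree c ∧ ∀ ℓ ∈ c.primeFactors,
    Zhang2014.IsKolyvaginPrime (W.conductorNorm ℤ) W K p ℓ} with hΛ
  let Dv : ∀ c : ℕ, ℕ → Prop := fun c u ↦ ∀ d : KolyvaginHeegnerData Dt β ι c,
    ∃ Q : (W.baseChange (ringClassField K ι c)).toAffine.Point, ((p ^ u : ℕ) : ℤ) • Q = d.derivedPoint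
  have hDv0 : ∀ c, Dv c 0 := fun c d ↦ ⟨d.derivedPoint, by simp⟩
  have hDvmono : ∀ c {u v : ℕ}, v ≤ u → Dv c u → Dv c v :=
    fun c u v huv h d ↦ exists_pow_smul_eq_of_le p huv (h d)
  -- the depth function `m'(c)` and its characterisation
  let mdivN : ℕ → ℕ∞ := fun c ↦
    if h : ∃ u, ¬ Dv c u then ((Nat.find h - 1 : ℕ) : ℕ∞) else ⊤
  have hchar : ∀ (c u : ℕ), (u : ℕ∞) ≤ mdivN c ↔ Dv c u := by
    intro c u
    by_cases h : ∃ u, ¬ Dv c u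
    · have hfind0 : 0 < Nat.find h := by
        rw [Nat.find_pos]
        exact fun h0 ↦ h0 (hDv0 c)
      simp only [mdivN, dif_pos h, ENat.coe_le_coe]
      constructor
      · intro hu
        have hlt : u < Nat.find h := by omega
        have := (Nat.lt_find_iff h u).mp hlt u le_rfl
        simpa using this
      · intro hu
        have hlt : u < Nat.find h := by
          rw [Nat.lt_find_iff]
          intro v hv hnv
          exact hnv (hDvmono c hv hu)
        omega
    · simp only [mdivN, dif_neg h, le_top, true_iff]
      exact not_not.mp (not_exists.mp h u)
  -- exact-depth witnesses at a finite depth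
  have hexact : ∀ (c u : ℕ), mdivN c = u →
      Dv c u ∧ ∃ d : KolyvaginHeegnerData Dt β ι c,
        (∃ Q : (W.baseChange (ringClassField K ι c)).toAffine.Point,
          ((p ^ u : ℕ) : ℤ) • Q = d.derivedPoint) ∧
        ¬ ∃ Q : (W.baseChange (ringClassField K ι c)).toAffine.Point,
          ((p ^ (u + 1) : ℕ) : ℤ) • Q = d.derivedPoint := by
    intro c u hcu
    have hu : Dv c u := (hchar c u).mp (by rw [hcu])
    have hu1 : ¬ Dv c (u + 1) := by
      rw [← hchar c (u + 1), hcu, ENat.coe_le_coe]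
      omega
    obtain ⟨d, hd⟩ := not_forall.mp hu1
    exact ⟨hu, d, hu d, hd⟩
  -- the functions on `Λ`
  let M : Λ → ℕ∞ := fun c ↦ Zhang2014.levelIndex W p c.1
  let mdiv : Λ → ℕ∞ := fun c ↦ mdivN c.1
  let m : Λ → ℕ∞ := fun c ↦ if mdiv c < M c then mdiv c else ⊤
  have hm : ∀ c, mdiv c < M c → m c ≤ mdiv c := fun c h ↦ by
    simp only [m, if_pos h]
    exact le_rfl
  -- the target conductor as an element of `Λ`, and `s ≤ M(n)`
  let cn : Λ := ⟨n, hn, fun ℓ h ↦ (hℓ ℓ h).1⟩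
  have hsM : (s : ℕ∞) ≤ M cn :=
    Zhang2014.natCast_le_levelIndex_iff.mpr fun ℓ h ↦ (hℓ ℓ h).2
  -- it suffices to bound the depth of conductor `n`
  suffices hgoal : (s : ℕ∞) ≤ mdiv cn from ((hchar n s).mp hgoal) d
  by_contra hlt
  rw [not_le] at hlt
  -- `m'(n)` is finite, `= u₀ < s ≤ M(n)`: McCallum's candidate set is non-empty
  obtain ⟨u₀, hu₀⟩ := ENat.ne_top_iff_exists.mp (ne_top_of_lt hlt)
  -- McCallum's set `⋃_r {u | ∃ c ∈ Λ^r, d : exact depth u, u + 1 ≤ M(ℓ) ∀ ℓ ∣ c}`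
  let T : ℕ → Prop := fun u ↦ ∃ (c : ℕ) (d : KolyvaginHeegnerData Dt β ι c), Squarefree c ∧
      (∀ ℓ ∈ c.primeFactors, Zhang2014.IsKolyvaginPrime (W.conductorNorm ℤ) W K p ℓ ∧
        u + 1 ≤ Zhang2014.kolyvaginIndex W p ℓ) ∧
      (∃ Q : (W.baseChange (ringClassField K ι c)).toAffine.Point,
        ((p ^ u : ℕ) : ℤ) • Q = d.derivedPoint) ∧
      ¬ ∃ Q : (W.baseChange (ringClassField K ι c)).toAffine.Point,
        ((p ^ (u + 1) : ℕ) : ℤ) • Q = d.derivedPoint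
  -- membership of every `c ∈ Λ` with `m'(c) < M(c)`
  have hTmem : ∀ (c : Λ) (u : ℕ), mdiv c = u → mdiv c < M c → T u := by
    intro c u hcu hcM
    obtain ⟨-, d', hd', hnd'⟩ := hexact c.1 u hcu
    have hu1 : ((u + 1 : ℕ) : ℕ∞) ≤ M c := by
      rw [hcu] at hcM
      have : (u : ℕ∞) + 1 ≤ M c := (ENat.add_one_le_iff (ENat.coe_ne_top u)).mpr hcM
      exact_mod_cast this
    exact ⟨c.1, d', c.2.1, fun ℓ h ↦ ⟨c.2.2 ℓ h, (Zhang2014.natCast_le_levelIndex_iff.mp hu1) ℓ h⟩,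
      hd', hnd'⟩
  have hT : ∃ u, T u := ⟨u₀, hTmem cn u₀ hu₀.symm (hlt.trans_le hsM)⟩
  -- `m_∞ := min T`
  set mInf : ℕ := Nat.find hT with hmInfdef
  have hmInfT : T mInf := Nat.find_spec hT
  have hmInfmin : ∀ u, T u → mInf ≤ u := fun u hu ↦ Nat.find_min' hT hu
  -- `hmInf : m_∞ ≤ m(c)`
  have hmInf : ∀ c, (mInf : ℕ∞) ≤ m c := by
    intro c
    by_cases hcM : mdiv c < M c
    · obtain ⟨u, hu⟩ := ENat.ne_top_iff_exists.mp (ne_top_of_lt hcM)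
      have : (mInf : ℕ∞) ≤ mdiv c := by
        rw [← hu, ENat.coe_le_coe]
        exact hmInfmin u (hTmem c u hu.symm hcM)
      simp only [m, if_pos hcM]
      exact this
    · simp only [m, if_neg hcM]
      exact le_top
  -- from an exact-depth-`mInf` datum with `mInf + 1 ≤ M(c)`: `m(c) = m_∞`
  have hmeq : ∀ (c : Λ) (d' : KolyvaginHeegnerData Dt β ι c.1),
      ((mInf + 1 : ℕ) : ℕ∞) ≤ M c →
      (¬ ∃ Q : (W.baseChange (ringClassField K ι c.1)).toAffine.Point,
        ((p ^ (mInf + 1) : ℕ) : ℤ) • Q = d'.derivedPoint) → m c = mInf := by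
    intro c d' hMc hnd'
    -- `m'(c) ≤ mInf`
    have hle : mdiv c ≤ mInf := by
      have h1 : ¬ ((mInf + 1 : ℕ) : ℕ∞) ≤ mdiv c := by
        rw [hchar c.1 (mInf + 1)]
        exact fun h ↦ hnd' (h d')
      rw [not_le] at h1
      have h2 : mdiv c < (mInf : ℕ∞) + 1 := by exact_mod_cast h1
      exact (ENat.lt_add_one_iff (ENat.coe_ne_top mInf)).mp h2
    have hcM : mdiv c < M c := by
      refine lt_of_le_of_lt hle ?_
      have : (mInf : ℕ∞) < (mInf : ℕ∞) + 1 :=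
        ENat.lt_add_one_iff (ENat.coe_ne_top mInf) |>.mpr le_rfl
      exact this.trans_le (by exact_mod_cast hMc)
    have hge : (mInf : ℕ∞) ≤ mdiv c := by
      have := hmInf c
      simp only [m, if_pos hcM] at this
      exact this
    simp only [m, if_pos hcM]
    exact le_antisymm hle hge
  -- `hK : ∀ m', ∃ c, m' ≤ M(c) ∧ m(c) = m_∞` — by LEVEL RAISING AT MINIMAL DEPTH (Kolyvagin's swap walk)
  have hminT : ∀ (c : ℕ), Squarefree c →
      (∀ q ∈ c.primeFactors, Zhang2014.IsKolyvaginPrime (W.conductorNorm ℤ) W K p q ∧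
        1 + mInf ≤ Zhang2014.kolyvaginIndex W p q) →
      ∀ dc : KolyvaginHeegnerData Dt β ι c,
      ∃ Q : (W.baseChange (ringClassField K ι c)).toAffine.Point,
        ((p ^ mInf : ℕ) : ℤ) • Q = dc.derivedPoint := by
    intro c hc hcK dc
    by_contra hnd
    -- the exact depth `u' < mInf` of `P_c^{(dc)}` is a competitor
    have hex : ∃ u', (∃ Q : (W.baseChange (ringClassField K ι c)).toAffine.Point,
        ((p ^ u' : ℕ) : ℤ) • Q = dc.derivedPoint) ∧
        ¬ ∃ Q : (W.baseChange (ringClassField K ι c)).toAffine.Point,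
          ((p ^ (u' + 1) : ℕ) : ℤ) • Q = dc.derivedPoint := by
      by_contra hall
      push Not at hall
      have : ∀ u', ∃ Q : (W.baseChange (ringClassField K ι c)).toAffine.Point,
          ((p ^ u' : ℕ) : ℤ) • Q = dc.derivedPoint := by
        intro u'
        induction u' with
        | zero => exact ⟨dc.derivedPoint, by simp⟩
        | succ u' ih => exact hall u' ih
      exact hnd (this mInf)
    obtain ⟨u', hu', hnu'⟩ := hex
    have hu'lt : u' < mInf := by
      by_contra hge
      rw [not_lt] at hge
      exact hnd (exists_pow_smul_eq_of_le p hge hu')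
    have hTu' : T u' := ⟨c, dc, hc, fun q hq ↦ ⟨(hcK q hq).1, by have := (hcK q hq).2; omega⟩, hu', hnu'⟩
    exact absurd (hmInfmin u' hTu') (by omega)
  have hKoly : ∀ m' : ℕ, ∃ c, (m' : ℕ∞) ≤ M c ∧ m c = mInf := by
    intro m'
    obtain ⟨c₀, d₀, hsq₀, hℓ₀, hd₀, hnd₀⟩ := hmInfT
    obtain ⟨c, d', hsq, hℓ', hnd'⟩ := hraise mInf hminT c₀ hsq₀
      (fun q hq ↦ ⟨(hℓ₀ q hq).1, by have := (hℓ₀ q hq).2; omega⟩) d₀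
      (by simpa only [Nat.add_comm] using hnd₀) m'
    let cc : Λ := ⟨c, hsq, fun q hq ↦ (hℓ' q hq).1⟩
    have hMc' : ((max m' (1 + mInf) : ℕ) : ℕ∞) ≤ M cc :=
      Zhang2014.natCast_le_levelIndex_iff.mpr fun q hq ↦ (hℓ' q hq).2
    refine ⟨cc, le_trans (by exact_mod_cast le_max_left m' (1 + mInf)) hMc', hmeq cc d'
      (le_trans (by exact_mod_cast (by omega : mInf + 1 ≤ max m' (1 + mInf))) hMc') ?_⟩
    simpa only [Nat.add_comm] using hnd'
  -- Prop. 6.4 and Thm. 6.3 for these data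
  obtain ⟨Core, h64, h63⟩ := H mdiv m (fun c u ↦ hchar c.1 u) (fun c ↦ rfl) mInf hmInf hKoly
  -- §6 abstract end form (minimal-core-vertex variant)
  have := Section6.depth_le_mdiv_of_le_mInfty M mdiv m hm mInf hmInf
    (Section6.tamagawaExponent_le_mInfty_of_coreVertices_min M m Core t mInf hmInf hKoly h64 h63)
    s hs cn hsM
  exact absurd this (not_le.mpr hlt)



end Summit.BirchSwinnertonDyer.Rank1Residual.JET

end
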